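import Mathlib
import Summits.KontsevichZagierPeriods.Zeta5Search.OddTwistHalfInt
import Summits.KontsevichZagierPeriods.Zeta5Search.OddTwistFactorisation
import HarnessLib

/-!
HONEST FRAMING: systematic search; no irrationality claim unless certified.

# The twisted family `T`: the half-shifted series and the window `ℚ + ℚζ(5) + ⋯ + ℚζ(q−1)` of `7F − F̂`

Cell `pub-zeta5`, lane `families/odd` (FAMILY.md §5.7–§5.10), fam-odd gen-3/gen-4 (part 2 of 2).  Companion to
`OddTwistReflection.lean` (reflection law; `Σ_k R(k+1) ∈ ℚ + Σ_{odd s} ℚζ(s)` via CFR Théorème 1),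
`OddTwistFactorisation.lean` (integer / half-integer zeros of the twisted Pochhammer) and `OddTwistHalfInt.lean`
(part 1: CFR Théorème 1 summed at the half-integers, `hasSum_of_pf_data_half` — same partial-fraction data, each
`ζ(s)` weighted by `2^s − 1`).

Mechanism [Zudilin, SIGMA 14 (2018) 028 = arXiv:1801.09895, (1), Lemma 3, §1]: `7r − r̂ ∈ ℚ + ℚζ(5) + ℚζ(7) + ⋯`
(the weight `7 = 2³ − 1` removes `ζ(3)`), applied to the twisted family `T` of FAMILY.md §5.7 (`twistCore q h₀ e h`):

* `twistBox_hasSum_halfShift` : for even `q ≥ 1`, `2h_j ≤ h₀` and the degree condition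
  `2h₀ + 4e + 3 + Σ_j 2h_j ≤ q(h₀+1)`: ONE sequence `a_s ∈ ℚ` with
  `Σ_k R(k+1) = a₀ + Σ_{odd s ≤ q} a_s ζ(s)` and `Σ_k R(k+½) = â₀ + Σ_{odd s ≤ q} a_s (2^s − 1) ζ(s)`;
* `twistForm_hasSum_window` : **the family's forms `ℓ = 7F − F̂` lie in `ℚ + ℚζ(5) + ℚζ(7) + ⋯ + ℚζ(q−1)`**
  (no `ζ(3)`, no even zeta values), hypothesis-free, all admissible integer parameters; coefficient of `ζ(s)` is
  `(8 − 2^s) a_s`;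
* `twistForm_hasSum_window_shifted` : the same series started at the family's own origin `t = e + 1`
  (`F = Σ_{t ≥ e+1} R(t)`, `F̂ = Σ_{t ≥ e+1} R(t − ½)`), using the zeros of `OddTwistReflection` /
  `OddTwistFactorisation`.

Everything here is exact and elementary (membership of the forms in the right ℚ-space); nothing asymptotic or
arithmetic (denominators, Lemma T19, rates `κ`) is claimed.  Lean's `x / 0 = 0` convention is harmless: every
evaluation point used is a non-pole.
-/

namespace Summit.KontsevichZagierPeriods.Zeta5Search

open Finset Filter Topology Polynomial
open Literature.NumberTheory.Transcendental
open Literature.NumberTheory.Transcendental.BallRivoal (pfEval harm hasSum_one_div_pow_shift hasSum_sub_shift)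
open Literature.NumberTheory.Irrationality.CressonFischlerRivoal2008

/-! ## Application to the twisted family `T` -/

section Twist

variable {q h₀ e : ℕ} {h : Fin q → ℕ}

/-- Normal form at ANY non-pole positive argument: `P(t)/(t)_{h₀+1}^q = R(t)` with `P = twistPoly`
(`P = twistNum · ∏_j c_j`, `(t)_{h₀+1} = c_j(t) · brick_j(t)`, `c_j(t) > 0` for `t > 0`). [this file] -/
theorem twistPoly_eval_div_poch (hh : ∀ j, 2 * h j ≤ h₀) (t : ℚ) (ht : 0 < t) :
    (twistPoly q h₀ e h).eval t / BallRivoal.poch t (h₀ * 1 + 1) ^ q = twistCore q h₀ e h t := by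
  have hC : (∏ j, laiCof h₀ (h j) 1 t) ≠ 0 :=
    (prod_pos fun j _ => laiCof_pos h₀ (h j) 1 (by have := hh j; omega) _ ht).ne'
  have e3 : BallRivoal.poch t (h₀ * 1 + 1) ^ q = laiDen q h₀ 1 h t * ∏ j, laiCof h₀ (h j) 1 t := by
    rw [BallRivoal.poch, laiDen, ← prod_mul_distrib]
    have hc : (∏ _j : Fin q, ∏ i ∈ range (h₀ * 1 + 1), (t + (i : ℚ))) =
        (∏ i ∈ range (h₀ * 1 + 1), (t + (i : ℚ))) ^ q := by
      rw [prod_const, Finset.card_univ, Fintype.card_fin]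
    rw [← hc]
    exact prod_congr rfl (fun j _ => by rw [poch_split h₀ (h j) 1 (hh j), mul_comm])
  rw [e3, twistPoly_eval, twistCore, mul_div_mul_right _ _ hC]

/-- **Integer and half-shifted series of the twisted family share their coefficients**: for an EVEN number
`q ≥ 1` of bricks with `2h_j ≤ h₀` and the degree condition `2h₀ + 4e + 3 + Σ_j 2h_j ≤ q(h₀+1)` there is ONE
sequence `a_s ∈ ℚ` (and constants `a₀, â₀ ∈ ℚ`) with
`Σ_{k ≥ 0} R(k+1) = a₀ + Σ_{3 ≤ s ≤ q, s odd} a_s ζ(s)` and `Σ_{k ≥ 0} R(k+½) = â₀ + Σ_{3 ≤ s ≤ q, s odd} a_s (2^s − 1) ζ(s)`.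
[this file; mechanism: Zudilin, SIGMA 14 (2018) 028, (1) and Lemma 3] -/
theorem twistBox_hasSum_halfShift (q h₀ e : ℕ) (h : Fin q → ℕ) (hq : Even q) (hq1 : 1 ≤ q)
    (hh : ∀ j, 2 * h j ≤ h₀)
    (hdeg : (2 * h₀ + 4 * e + 1) + (∑ j, 2 * (h j * 1)) + 2 ≤ q * (h₀ * 1 + 1)) :
    ∃ a : ℕ → ℚ, ∃ a₀ â₀ : ℚ,
      HasSum (fun k : ℕ => ((twistCore q h₀ e h ((k : ℚ) + 1) : ℚ) : ℝ))
          ((a₀ : ℝ) + ∑ s ∈ (Finset.Icc 3 q).filter Odd, (a s : ℝ) * zetaValue s) ∧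
        HasSum (fun k : ℕ => ((twistCore q h₀ e h ((k : ℚ) + 1 / 2) : ℚ) : ℝ))
          ((â₀ : ℝ) + ∑ s ∈ (Finset.Icc 3 q).filter Odd, (a s : ℝ) * ((2 ^ s - 1) * zetaValue s)) := by
  set P : ℚ[X] := twistPoly q h₀ e h with hPdef
  have hdeg' : P.natDegree + 2 ≤ q * (h₀ * 1 + 1) :=
    (Nat.add_le_add_right twistPoly_natDegree_le 2).trans hdeg
  have hsym : P.comp (-((h₀ * 1 : ℕ) : ℚ[X]) - X) = (-1 : ℚ[X]) ^ (q * (h₀ * 1 + 1) + 1) * P :=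
    twistPoly_symm hq
  set Q : ℚ[X] := P.comp (X + C 1) with hQdef
  have hQnat : Q.natDegree = P.natDegree := by
    rw [hQdef, natDegree_comp, natDegree_X_add_C, mul_one]
  have hQdeg : Q.degree < ((q * (h₀ * 1 + 1) : ℕ) : WithBot ℕ) :=
    degree_le_natDegree.trans_lt (by exact_mod_cast (by omega : Q.natDegree < q * (h₀ * 1 + 1)))
  obtain ⟨c, hc⟩ := exists_partialFractions (h₀ * 1) q hq1 Q hQdeg
  refine ⟨fun s => ∑ p ∈ range (h₀ * 1 + 1), c (s - 1) p,
    -∑ o ∈ range q, ∑ p ∈ range (h₀ * 1 + 1), c o p * harm (o + 1) p,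
    -∑ o ∈ range q, ∑ p ∈ range (h₀ * 1 + 1), c o p * harmHalf (o + 1) p, ?_, ?_⟩
  · -- integer points: CFR Théorème 1 with explicit coefficients
    have hS := hasSum_of_pf_data (h₀ * 1) q P hq1 hdeg' hsym c hc
    have hterm : ∀ k : ℕ, (aeval ((k : ℝ) + 1) P) / poch (k + 1) (h₀ * 1) ^ q =
        ((twistCore q h₀ e h ((k : ℚ) + 1) : ℚ) : ℝ) := by
      intro k
      have e1 : aeval ((k : ℝ) + 1) P = ((P.eval ((k : ℚ) + 1) : ℚ) : ℝ) := by
        have : ((k : ℝ) + 1) = algebraMap ℚ ℝ ((k : ℚ) + 1) := by rw [eq_ratCast]; push_cast; rfl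
        rw [this, aeval_algebraMap_apply_eq_algebraMap_eval, eq_ratCast]
      have e2 : poch (k + 1) (h₀ * 1) = ((BallRivoal.poch ((k : ℚ) + 1) (h₀ * 1 + 1) : ℚ) : ℝ) := by
        unfold poch BallRivoal.poch; push_cast; rfl
      rw [e1, e2, ← Rat.cast_pow, ← Rat.cast_div, hPdef, twistPoly_eval_div_poch hh _ (by positivity)]
    have hfun : (fun k : ℕ => (aeval ((k : ℝ) + 1) P) / poch (k + 1) (h₀ * 1) ^ q) =
        fun k : ℕ => ((twistCore q h₀ e h ((k : ℚ) + 1) : ℚ) : ℝ) := funext hterm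
    rw [← hfun]
    convert hS using 1
    push_cast
    ring
  · -- half-integer points: the half-shifted summation, same data `c`
    have hS := hasSum_of_pf_data_half (h₀ * 1) q P hq1 hdeg' hsym c hc
    have hfun : (fun k : ℕ =>
        ((P.eval ((k : ℚ) + 1 / 2) / BallRivoal.poch ((k : ℚ) + 1 / 2) (h₀ * 1 + 1) ^ q : ℚ) : ℝ)) =
        fun k : ℕ => ((twistCore q h₀ e h ((k : ℚ) + 1 / 2) : ℚ) : ℝ) := by
      funext k
      rw [hPdef, twistPoly_eval_div_poch hh _ (by positivity)]
    rw [← hfun]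
    convert hS using 1
    push_cast
    ring

/-- **The twisted family's forms lie in `ℚ + ℚζ(5) + ℚζ(7) + ⋯ + ℚζ(q−1)`** (hypothesis-free): for an EVEN number
`q ≥ 1` of bricks with `2h_j ≤ h₀` and the degree condition, the series
`Σ_{k ≥ 0} (7·R(k+1) − R(k+½))` — the family's `ℓ = 7F − F̂` up to its normalising constant — converges to
`b₀ + Σ_{5 ≤ s ≤ q, s odd} b_s ζ(s)` with `b_s = (8 − 2^s) a_s ∈ ℚ`: the weight `7 = 2³ − 1` removes `ζ(3)`, the
well-poised reflection removes the even zeta values. For `q = 8` the window is `{ζ(5), ζ(7)}`, for `q = 10` it is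
`{ζ(5), ζ(7), ζ(9)}`. [this file; mechanism: Zudilin, SIGMA 14 (2018) 028, §1] -/
theorem twistForm_hasSum_window (q h₀ e : ℕ) (h : Fin q → ℕ) (hq : Even q) (hq1 : 1 ≤ q)
    (hh : ∀ j, 2 * h j ≤ h₀)
    (hdeg : (2 * h₀ + 4 * e + 1) + (∑ j, 2 * (h j * 1)) + 2 ≤ q * (h₀ * 1 + 1)) :
    ∃ b : ℕ → ℚ, ∃ b₀ : ℚ,
      HasSum (fun k : ℕ =>
          ((7 * twistCore q h₀ e h ((k : ℚ) + 1) - twistCore q h₀ e h ((k : ℚ) + 1 / 2) : ℚ) : ℝ))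
        ((b₀ : ℝ) + ∑ s ∈ (Finset.Icc 5 q).filter Odd, (b s : ℝ) * zetaValue s) := by
  obtain ⟨a, a₀, â₀, H1, H2⟩ := twistBox_hasSum_halfShift q h₀ e h hq hq1 hh hdeg
  refine ⟨fun s => (8 - 2 ^ s) * a s, 7 * a₀ - â₀, ?_⟩
  have H : HasSum (fun k : ℕ => 7 * ((twistCore q h₀ e h ((k : ℚ) + 1) : ℚ) : ℝ) -
        ((twistCore q h₀ e h ((k : ℚ) + 1 / 2) : ℚ) : ℝ))
      (7 * ((a₀ : ℝ) + ∑ s ∈ (Finset.Icc 3 q).filter Odd, (a s : ℝ) * zetaValue s) -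
        ((â₀ : ℝ) + ∑ s ∈ (Finset.Icc 3 q).filter Odd, (a s : ℝ) * ((2 ^ s - 1) * zetaValue s))) :=
    (H1.mul_left (7 : ℝ)).sub H2
  have hfun : (fun k : ℕ =>
      ((7 * twistCore q h₀ e h ((k : ℚ) + 1) - twistCore q h₀ e h ((k : ℚ) + 1 / 2) : ℚ) : ℝ)) =
      fun k : ℕ => 7 * ((twistCore q h₀ e h ((k : ℚ) + 1) : ℚ) : ℝ) -
        ((twistCore q h₀ e h ((k : ℚ) + 1 / 2) : ℚ) : ℝ) := by
    funext k; push_cast; ring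
  rw [hfun]
  convert H using 1
  have hsub : (Icc 5 q).filter Odd ⊆ (Icc 3 q).filter Odd := by
    intro s hs
    simp only [mem_filter, mem_Icc] at hs ⊢
    exact ⟨⟨le_trans (by norm_num) hs.1.1, hs.1.2⟩, hs.2⟩
  have hvan : ∀ s ∈ (Icc 3 q).filter Odd, s ∉ (Icc 5 q).filter Odd →
      ((((8 - 2 ^ s) * a s : ℚ)) : ℝ) * zetaValue s = 0 := by
    intro s hs hs'
    rw [mem_filter, mem_Icc] at hs
    obtain ⟨⟨h3, hsq⟩, hodd⟩ := hs
    have hs5 : ¬ (5 ≤ s) := fun h5 => hs' (mem_filter.2 ⟨mem_Icc.2 ⟨h5, hsq⟩, hodd⟩)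
    have h3' : s = 3 := by
      obtain ⟨m, hm⟩ := hodd
      omega
    subst h3'
    push_cast
    norm_num
  rw [sum_subset hsub hvan]
  have key : ∑ s ∈ (Icc 3 q).filter Odd, ((((8 - 2 ^ s) * a s : ℚ)) : ℝ) * zetaValue s =
      7 * ∑ s ∈ (Icc 3 q).filter Odd, (a s : ℝ) * zetaValue s -
        ∑ s ∈ (Icc 3 q).filter Odd, (a s : ℝ) * ((2 ^ s - 1) * zetaValue s) := by
    rw [Finset.mul_sum, ← sum_sub_distrib]
    refine sum_congr rfl fun s _ => ?_
    push_cast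
    ring
  rw [key]
  push_cast
  ring

/-- **The same statement with the family's own summation origin** `t = e + 1`
(`F = Σ_{t ≥ e+1} R(t)`, `F̂ = Σ_{t ≥ e+1} R(t − ½)`, FAMILY.md §5.7): the first `e` terms of both series vanish
(`twistNum_natCast_eq_zero`, `twistCore_intCast_sub_half_eq_zero`), so
`Σ_{k ≥ 0} (7·R(k+e+1) − R(k+e+½)) = b₀ + Σ_{5 ≤ s ≤ q, s odd} b_s ζ(s)` with the same `b`. [this file] -/
theorem twistForm_hasSum_window_shifted (q h₀ e : ℕ) (h : Fin q → ℕ) (hq : Even q) (hq1 : 1 ≤ q)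
    (hh : ∀ j, 2 * h j ≤ h₀)
    (hdeg : (2 * h₀ + 4 * e + 1) + (∑ j, 2 * (h j * 1)) + 2 ≤ q * (h₀ * 1 + 1)) :
    ∃ b : ℕ → ℚ, ∃ b₀ : ℚ,
      HasSum (fun k : ℕ =>
          ((7 * twistCore q h₀ e h ((k : ℚ) + e + 1) - twistCore q h₀ e h ((k : ℚ) + e + 1 / 2) : ℚ) : ℝ))
        ((b₀ : ℝ) + ∑ s ∈ (Finset.Icc 5 q).filter Odd, (b s : ℝ) * zetaValue s) := by
  obtain ⟨b, b₀, H⟩ := twistForm_hasSum_window q h₀ e h hq hq1 hh hdeg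
  refine ⟨b, b₀, ?_⟩
  have H' := (hasSum_nat_add_iff' (f := fun k : ℕ =>
      ((7 * twistCore q h₀ e h ((k : ℚ) + 1) - twistCore q h₀ e h ((k : ℚ) + 1 / 2) : ℚ) : ℝ)) e).2 H
  have hzero : ∑ i ∈ range e,
      ((7 * twistCore q h₀ e h ((i : ℚ) + 1) - twistCore q h₀ e h ((i : ℚ) + 1 / 2) : ℚ) : ℝ) = 0 := by
    refine sum_eq_zero fun i hi => ?_
    have hi' : i < e := mem_range.1 hi
    have h1 : twistCore q h₀ e h ((i : ℚ) + 1) = 0 := by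
      have := twistNum_natCast_eq_zero h₀ e (i + 1) (by omega)
      unfold twistCore
      rw [show (i : ℚ) + 1 = ((i + 1 : ℕ) : ℚ) by push_cast; ring, this, zero_div]
    have h2 : twistCore q h₀ e h ((i : ℚ) + 1 / 2) = 0 := by
      have := twistCore_intCast_sub_half_eq_zero q h₀ e h ((i : ℤ) + 1) (by omega) (by omega)
      rw [show (((i : ℤ) + 1 : ℤ) : ℚ) - 1 / 2 = (i : ℚ) + 1 / 2 by push_cast; ring] at this
      exact this
    rw [h1, h2]
    push_cast
    ring
  rw [hzero, sub_zero] at H'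
  refine H'.congr_fun fun k => ?_
  simp only [Nat.cast_add]

end Twist

/-! ## Sanity instances -/

/-- `Ĥ_2^{(1)} = 1/(½) + 1/(3/2) = 8/3`. [this file] -/
example : harmHalf 1 2 = 8 / 3 := by norm_num [harmHalf, Finset.sum_range_succ]

/-- The record plateau design of FAMILY.md §5.9 at its smallest integer scale `n = 48`:
`q = 8` bricks `(1, 3, 5, 7, 9, 11, 13, 15)`, `h₀ = 48`, `e = 15` — its form `7F − F̂` lies in
`ℚ + ℚζ(5) + ℚζ(7)`, by the general theorem. [this file] -/
example : ∃ b : ℕ → ℚ, ∃ b₀ : ℚ,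
    HasSum (fun k : ℕ => ((7 * twistCore 8 48 15 ![1, 3, 5, 7, 9, 11, 13, 15] ((k : ℚ) + 1) -
        twistCore 8 48 15 ![1, 3, 5, 7, 9, 11, 13, 15] ((k : ℚ) + 1 / 2) : ℚ) : ℝ))
      ((b₀ : ℝ) + ((b 5 : ℝ) * zetaValue 5 + (b 7 : ℝ) * zetaValue 7)) := by
  obtain ⟨b, b₀, H⟩ := twistForm_hasSum_window 8 48 15 ![1, 3, 5, 7, 9, 11, 13, 15] ⟨4, rfl⟩ (by norm_num)
    (by decide) (by decide)
  refine ⟨b, b₀, ?_⟩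
  have hset : (Finset.Icc 5 8).filter Odd = {5, 7} := by decide
  rw [hset, Finset.sum_pair (by norm_num)] at H
  exact H

end Summit.KontsevichZagierPeriods.Zeta5Search
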